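import Mathlib
import Summits.NavierStokesRegularity.FluidComputer.BorderedHeadTailBound

/-!
# THEOREM 3-B-NESTED (a) STEPS 2–3 as an a-priori estimate: the bordered head carries the head part `ṽ_h` of the column vector, the tail part `ṽ_t` enters as rank-one terms (profile-cert-3 g4, cell `ns-blowup`, 2026-08-26)

HONEST FRAMING (human rulings D-0035/D-0074): nothing here is a claim about Navier–Stokes blow-up.
WHAT THIS IS NOT: not NS evidence. Abstract inner-product-space estimate; its consumer is the NESTED
form of THEOREM 3-B actually run by all three F5 implementations of GROUP B (cap `SKEWCUT-PAIR.md` §9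
(N1)–(N7), instab `CERT-ROPE-X0.md` §B; rows `CertificateAbcSpectrum*`): the float vector `ṽ` lives
at level `K_V > K₀`, the bordered operator is `𝔅₀(w, μ) = ((λ̃ − L)w + μṽ, ⟨w, ṽ_h⟩)` with COLUMN `ṽ`
and ROW `ṽ_h = Π_{K₀}ṽ`, the bordered HEAD is `Â₀ = [[A^{(K₀)}(λ̃), ṽ_h], [ṽ_h*, 0]]`, and the leftover
`ṽ_t = ṽ − ṽ_h` is fed into the tail: `μ_eff = MU2_b,0 − ‖B*_{K₀}g‖‖ṽ_t‖` (N4),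
`β_C′ = ‖C_{K₀}E*Â₀⁻¹‖ + ‖ṽ_t‖‖e_μ*Â₀⁻¹‖` (N5). Companion of `BorderedHeadTailBound` (same seat), whose
`apriori_bound_of_head_tail` is the case `ṽ ∈ Π_{K₀}H` (`ṽ_t = 0`).

* `apriori_bound_of_nested_head_tail` — in resolvent coordinates (`(λ̃ − L)(S₀ w) = R w`,
  `D(L) = range S₀`, unknown measured by `v = S₀ w`): head/tail split by the star projection `P` onto
  `U`; column vector `v` ARBITRARY; `φ` vanishing on `Uᗮ`; a linear LEFT inverse `Ainv` of the nested
  head `(u, μ) ↦ (P R u + μ P v, φ u)` on `U × 𝕜` with `α ≥ ‖Â₀⁻¹‖`, `β_B ≥ ‖Â₀⁻¹B̂‖`, and the NESTED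
  `β_C′`: `‖(1 − P) R (Ainv (y, g)).1 + (Ainv (y, g)).2 • (v − P v)‖ ≤ β_C′‖(y, g)‖`; the NESTED tail
  coercivity `μ‖S₀ w‖² ≤ Re⟪R w − R a.1 − a.2 • (v − P v), S₀ w⟫`, `a = Ainv (P R w, 0)`, on `Uᗮ`
  (`μ = μ_eff`). CONCLUSION: `‖(S₀ w, m)‖ ≤ M₀‖(R w + m • v, φ w)‖` for all `(w, m)` with the printed
  `M₀ = √((1 + β_C′²)/μ² + (α + β_B√(1 + β_C′²)/μ)²)`.
* `apriori_bound_of_nested_head_tail_inner` — the same with the 3-B-nested row functional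
  `φ = ⟪v_r, S₀ ·⟫`, `v_r ∈ U` (`v_r = ṽ_h`).

The a-priori bound is what `BorderedResolventFredholm.bordered_inverse_of_apriori` (Fredholm: 𝔅₀
bijective, `‖(S₀ ⊕ 1)𝔅₀⁻¹‖ ≤ M₀`) and the nested isolation / master files consume. Mathlib +
`BorderedHeadTailBound`; no new definitions. bears_on LADDER-NS N5 / Z4-a(1)(2); evidence-only for
`EpisodeBase` (stmt-NavierStokesRegularity-19179).
-/

open scoped InnerProductSpace

namespace Summit.NavierStokesRegularity.FluidComputer.BorderedHeadTailBoundNested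

open BorderedHeadTailBound

variable {𝕜 H : Type*} [RCLike 𝕜] [NormedAddCommGroup H] [InnerProductSpace 𝕜 H]

/-- **THEOREM 3-B-NESTED (a) STEPS 2–3 as an a-priori estimate (SKEWCUT-PAIR §9 (N2)/(N4)/(N5)).**
NESTED means: the column vector `v` (= the float `ṽ` at level `K_V > K₀`) need NOT lie in the head `U`;
the bordered HEAD uses its head part `P v` (`= ṽ_h`, (N2)), the functional `φ` still vanishes on `Uᗮ`
(the row is `⟨·, ṽ_h⟩`), and the tail part `v − P v = ṽ_t` enters the tail Schur form and the constant
`β_C′` as the RANK-ONE terms `(Ainv …).2 • (v − P v)` ((N4): `μ_eff = MU2_b,0 − ‖B*g‖‖ṽ_t‖`; (N5):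
`β_C′ = ‖C E*Â₀⁻¹‖ + ‖ṽ_t‖‖e_μ*Â₀⁻¹‖`). For `v ∈ U` this is `BorderedHeadTailBound.apriori_bound_of_head_tail`.
SETTING: `P` the star projection onto a complete subspace `U` of the inner
product space `H` (head), `S₀` bounded preserving `U` and `Uᗮ`, `v : H` the column vector (arbitrary),
`φ` a linear functional vanishing on `Uᗮ`, `R` bounded. HEAD DATA: a linear `Ainv` on `H × 𝕜`, LEFT
inverse on `U × 𝕜` of the nested bordered head, `Ainv (P (R u) + μ • P v, φ u) = (u, μ)` for `u ∈ U`,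
with, in the `v = S₀ w` measure, `‖(S₀ ⊕ 1)(Ainv (y, g))‖ ≤ α‖(y, g)‖` (`y ∈ U`),
`‖(S₀ ⊕ 1)(Ainv (P (R w), 0))‖ ≤ β_B‖S₀ w‖` (`w ∈ Uᗮ`), and the nested
`‖(1 − P) R (Ainv (y, g)).1 + (Ainv (y, g)).2 • (v − P v)‖ ≤ β_C‖(y, g)‖` (`y ∈ U`). TAIL DATA:
`μ‖S₀ w‖² ≤ Re⟪R w − R a.1 − a.2 • (v − P v), S₀ w⟫`, `a = Ainv (P (R w), 0)`, for `w ∈ Uᗮ`, `μ > 0`.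
CONCLUSION: `‖(S₀ w, m)‖ ≤ √((1 + β_C²)/μ² + (α + β_B√(1 + β_C²)/μ)²) · ‖(R w + m • v, φ w)‖` for every
`(w, m)`. Proof as in the non-nested case: with `f = R w + m • v`, `g = φ w`, the head equation gives
`(w_h, m) = Ainv (P f, g) − Ainv (P (R w_T), 0)`; the nested Schur expression at `w_T` differs from
`(1 − P) f − [(1 − P) R (Ainv (P f, g)).1 + (Ainv (P f, g)).2 • (v − P v)]` by a vector of `U` (the terms
`m • (v − P v)` cancel exactly), whence `‖S₀ w_T‖ ≤ (‖(1 − P) f‖ + β_C‖(P f, g)‖)/μ`; back-substitution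
(`CertifierNormBounds.sq_add_sq_le_backSubst`) and Pythagoras conclude. [folklore] -/
theorem apriori_bound_of_nested_head_tail (R S₀ : H →L[𝕜] H) (U : Submodule 𝕜 H)
    [U.HasOrthogonalProjection]
    (hS₀U : ∀ u ∈ U, S₀ u ∈ U) (hS₀U' : ∀ w ∈ Uᗮ, S₀ w ∈ Uᗮ)
    (v : H) (φ : H →ₗ[𝕜] 𝕜) (hφ : ∀ w ∈ Uᗮ, φ w = 0)
    (Ainv : (H × 𝕜) →ₗ[𝕜] (H × 𝕜))
    (hAleft : ∀ u ∈ U, ∀ m : 𝕜,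
      Ainv (U.starProjection (R u) + m • U.starProjection v, φ u) = (u, m))
    {α βB βC μ : ℝ} (hμ : 0 < μ) (hα : 0 ≤ α) (hβB : 0 ≤ βB) (hβC : 0 ≤ βC)
    (hαb : ∀ y ∈ U, ∀ g : 𝕜,
      ‖WithLp.toLp 2 (S₀ (Ainv (y, g)).1, (Ainv (y, g)).2)‖ ≤ α * ‖WithLp.toLp 2 (y, g)‖)
    (hβBb : ∀ w ∈ Uᗮ,
      ‖WithLp.toLp 2 (S₀ (Ainv (U.starProjection (R w), 0)).1,
          (Ainv (U.starProjection (R w), 0)).2)‖ ≤ βB * ‖S₀ w‖)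
    (hβCb : ∀ y ∈ U, ∀ g : 𝕜,
      ‖R (Ainv (y, g)).1 - U.starProjection (R (Ainv (y, g)).1) +
          (Ainv (y, g)).2 • (v - U.starProjection v)‖ ≤ βC * ‖WithLp.toLp 2 (y, g)‖)
    (hcoer : ∀ w ∈ Uᗮ, μ * ‖S₀ w‖ ^ 2 ≤
      RCLike.re ⟪R w - R (Ainv (U.starProjection (R w), 0)).1 -
        (Ainv (U.starProjection (R w), 0)).2 • (v - U.starProjection v), S₀ w⟫_𝕜)
    (w : H) (m : 𝕜) :
    ‖WithLp.toLp 2 (S₀ w, m)‖ ≤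
      √((1 + βC ^ 2) / μ ^ 2 + (α + βB * √(1 + βC ^ 2) / μ) ^ 2) *
        ‖WithLp.toLp 2 (R w + m • v, φ w)‖ := by
  set P := U.starProjection with hP
  -- split `w`
  set wh : H := P w with hwh
  set wT : H := w - P w with hwT
  have hwhU : wh ∈ U := U.starProjection_apply_mem w
  have hwTU : wT ∈ Uᗮ := U.sub_starProjection_mem_orthogonal w
  have hsplit : w = wh + wT := by rw [hwh, hwT]; abel
  -- data
  set f : H := R w + m • v with hf
  set fh : H := P f with hfh
  set fT : H := f - P f with hfT
  set g : 𝕜 := φ w with hg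
  have hfhU : fh ∈ U := U.starProjection_apply_mem f
  have hfTU : fT ∈ Uᗮ := U.sub_starProjection_mem_orthogonal f
  have hgh : φ wh = g := by
    rw [hg, hsplit, map_add, hφ wT hwTU, add_zero]
  -- head identity: `P (R wh) + m • P v = fh - P (R wT)`
  have hhead : P (R wh) + m • P v = fh - P (R wT) := by
    rw [hfh, hf, hsplit, map_add, map_add, map_add, map_smul]; abel
  set A1 := Ainv (fh, g) with hA1
  set A2 := Ainv (P (R wT), 0) with hA2
  have hwm : ((wh, m) : H × 𝕜) = A1 - A2 := by
    have h1 : Ainv ((fh, g) - (P (R wT), (0 : 𝕜))) = A1 - A2 := by rw [map_sub]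
    rw [← h1, Prod.mk_sub_mk, sub_zero, ← hhead, ← hgh]
    exact (hAleft wh hwhU m).symm
  have hwh' : wh = A1.1 - A2.1 := by
    have := congrArg Prod.fst hwm; simpa using this
  have hm' : m = A1.2 - A2.2 := by
    have := congrArg Prod.snd hwm; simpa using this
  -- head bound
  have hH : ‖WithLp.toLp 2 (S₀ wh, m)‖ ≤ α * ‖WithLp.toLp 2 (fh, g)‖ + βB * ‖S₀ wT‖ := by
    have h1 := hαb fh hfhU g
    have h2 := hβBb wT hwTU
    have heq : WithLp.toLp 2 (S₀ wh, m) =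
        WithLp.toLp 2 (S₀ A1.1, A1.2) - WithLp.toLp 2 (S₀ A2.1, A2.2) := by
      rw [← WithLp.toLp_sub, Prod.mk_sub_mk, ← map_sub, ← hwh', ← hm']
    rw [heq]
    exact (norm_sub_le _ _).trans (add_le_add h1 h2)
  -- tail identity: the nested Schur form at `wT` (rank-one term from `v - P v`) equals
  -- `fT - [(1 - P) (R A1.1) + A1.2 • (v - P v)]` up to a vector of `U`
  have hS₀wT : S₀ wT ∈ Uᗮ := hS₀U' wT hwTU
  have htail : RCLike.re ⟪R wT - R A2.1 - A2.2 • (v - P v), S₀ wT⟫_𝕜 =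
      RCLike.re ⟪fT - (R A1.1 - P (R A1.1) + A1.2 • (v - P v)), S₀ wT⟫_𝕜 := by
    have hA2eq : A2.1 = A1.1 - wh := by rw [hwh']; abel
    have hA2eq' : A2.2 = A1.2 - m := by rw [hm']; abel
    have hRA2 : R A2.1 = R A1.1 - R wh := by rw [hA2eq, map_sub]
    have hRw : R w = R wh + R wT := by rw [← map_add, ← hsplit]
    have hdiff : (R wT - R A2.1 - A2.2 • (v - P v)) - (fT - (R A1.1 - P (R A1.1) + A1.2 • (v - P v)))
        = P (R wh) + P (R wT) - P (R A1.1) := by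
      rw [hRA2, hA2eq', hfT, hf, hRw, map_add, map_add, map_smul]
      simp only [sub_smul, smul_sub]
      abel
    have hdiffU : (R wT - R A2.1 - A2.2 • (v - P v)) -
        (fT - (R A1.1 - P (R A1.1) + A1.2 • (v - P v))) ∈ U := by
      rw [hdiff]
      exact U.sub_mem (U.add_mem (U.starProjection_apply_mem _) (U.starProjection_apply_mem _))
        (U.starProjection_apply_mem _)
    have h0 : ⟪(R wT - R A2.1 - A2.2 • (v - P v)) -
        (fT - (R A1.1 - P (R A1.1) + A1.2 • (v - P v))), S₀ wT⟫_𝕜 = 0 :=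
      Submodule.inner_right_of_mem_orthogonal hdiffU hS₀wT
    rw [inner_sub_left, sub_eq_zero] at h0
    rw [h0]
  -- tail bound
  have hTb : ‖S₀ wT‖ ≤ (‖fT‖ + βC * ‖WithLp.toLp 2 (fh, g)‖) / μ := by
    have hc := hcoer wT hwTU
    rw [htail] at hc
    have hcs : RCLike.re ⟪fT - (R A1.1 - P (R A1.1) + A1.2 • (v - P v)), S₀ wT⟫_𝕜 ≤
        ‖fT - (R A1.1 - P (R A1.1) + A1.2 • (v - P v))‖ * ‖S₀ wT‖ := re_inner_le_norm _ _
    have hn : ‖fT - (R A1.1 - P (R A1.1) + A1.2 • (v - P v))‖ ≤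
        ‖fT‖ + βC * ‖WithLp.toLp 2 (fh, g)‖ :=
      (norm_sub_le _ _).trans (add_le_add le_rfl (hβCb fh hfhU g))
    have hpos : 0 ≤ ‖fT‖ + βC * ‖WithLp.toLp 2 (fh, g)‖ := by positivity
    rw [le_div_iff₀ hμ]
    have h3 : μ * ‖S₀ wT‖ ^ 2 ≤ (‖fT‖ + βC * ‖WithLp.toLp 2 (fh, g)‖) * ‖S₀ wT‖ :=
      hc.trans (hcs.trans (mul_le_mul_of_nonneg_right hn (norm_nonneg _)))
    by_cases hs : ‖S₀ wT‖ = 0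
    · rw [hs, zero_mul]; exact hpos
    · have hs' : 0 < ‖S₀ wT‖ := lt_of_le_of_ne (norm_nonneg _) (Ne.symm hs)
      rw [pow_two, ← mul_assoc] at h3
      rw [mul_comm]
      exact le_of_mul_le_mul_right h3 hs'
  -- back-substitution in the ℓ²-product norm
  have key := CertifierNormBounds.WithLp.norm_le_backSubst_mul_norm
    (WithLp.toLp 2 (WithLp.toLp 2 (fh, g), fT) : WithLp 2 (WithLp 2 (H × 𝕜) × H))
    (WithLp.toLp 2 (WithLp.toLp 2 (S₀ wh, m), S₀ wT) : WithLp 2 (WithLp 2 (H × 𝕜) × H))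
    hμ hα hβB hβC hTb hH
  -- identify the norms (Pythagoras across `U ⊕ Uᗮ`)
  have hS₀whU : S₀ wh ∈ U := hS₀U wh hwhU
  have hS₀w : S₀ w = S₀ wh + S₀ wT := by rw [← map_add, ← hsplit]
  have hy' : ‖(WithLp.toLp 2 (WithLp.toLp 2 (S₀ wh, m), S₀ wT) : WithLp 2 (WithLp 2 (H × 𝕜) × H))‖
      = ‖WithLp.toLp 2 (S₀ w, m)‖ := by
    have h1 : ‖(WithLp.toLp 2 (WithLp.toLp 2 (S₀ wh, m), S₀ wT) :
        WithLp 2 (WithLp 2 (H × 𝕜) × H))‖ ^ 2 = ‖WithLp.toLp 2 (S₀ w, m)‖ ^ 2 := by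
      rw [norm_toLp_toLp_sq, norm_toLp_sq, hS₀w, norm_add_sq_of_mem_orthogonal U hS₀whU hS₀wT]
      ring
    exact (pow_left_inj₀ (norm_nonneg _) (norm_nonneg _) two_ne_zero).mp h1
  have hfsplit : f = fh + fT := by rw [hfh, hfT]; abel
  have hx' : ‖(WithLp.toLp 2 (WithLp.toLp 2 (fh, g), fT) : WithLp 2 (WithLp 2 (H × 𝕜) × H))‖
      = ‖WithLp.toLp 2 (f, g)‖ := by
    have h1 : ‖(WithLp.toLp 2 (WithLp.toLp 2 (fh, g), fT) :
        WithLp 2 (WithLp 2 (H × 𝕜) × H))‖ ^ 2 = ‖WithLp.toLp 2 (f, g)‖ ^ 2 := by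
      rw [norm_toLp_toLp_sq, norm_toLp_sq, hfsplit, norm_add_sq_of_mem_orthogonal U hfhU hfTU]
      ring
    exact (pow_left_inj₀ (norm_nonneg _) (norm_nonneg _) two_ne_zero).mp h1
  rw [← hy', ← hx']
  exact key

/-- **3-B-NESTED (a) STEPS 2–3 with the row functional `φ = ⟪v_r, S₀ ·⟫`, `v_r ∈ U`** (the
normalisation `⟨w, ṽ_h⟩` of (N2) in resolvent coordinates): hypotheses and conclusion of
`apriori_bound_of_nested_head_tail`, the vanishing of `φ` on `Uᗮ` being automatic. [folklore] -/
theorem apriori_bound_of_nested_head_tail_inner (R S₀ : H →L[𝕜] H) (U : Submodule 𝕜 H)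
    [U.HasOrthogonalProjection]
    (hS₀U : ∀ u ∈ U, S₀ u ∈ U) (hS₀U' : ∀ w ∈ Uᗮ, S₀ w ∈ Uᗮ)
    (v vr : H) (hvr : vr ∈ U) (Ainv : (H × 𝕜) →ₗ[𝕜] (H × 𝕜))
    (hAleft : ∀ u ∈ U, ∀ m : 𝕜,
      Ainv (U.starProjection (R u) + m • U.starProjection v, ⟪vr, S₀ u⟫_𝕜) = (u, m))
    {α βB βC μ : ℝ} (hμ : 0 < μ) (hα : 0 ≤ α) (hβB : 0 ≤ βB) (hβC : 0 ≤ βC)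
    (hαb : ∀ y ∈ U, ∀ g : 𝕜,
      ‖WithLp.toLp 2 (S₀ (Ainv (y, g)).1, (Ainv (y, g)).2)‖ ≤ α * ‖WithLp.toLp 2 (y, g)‖)
    (hβBb : ∀ w ∈ Uᗮ,
      ‖WithLp.toLp 2 (S₀ (Ainv (U.starProjection (R w), 0)).1,
          (Ainv (U.starProjection (R w), 0)).2)‖ ≤ βB * ‖S₀ w‖)
    (hβCb : ∀ y ∈ U, ∀ g : 𝕜,
      ‖R (Ainv (y, g)).1 - U.starProjection (R (Ainv (y, g)).1) +
          (Ainv (y, g)).2 • (v - U.starProjection v)‖ ≤ βC * ‖WithLp.toLp 2 (y, g)‖)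
    (hcoer : ∀ w ∈ Uᗮ, μ * ‖S₀ w‖ ^ 2 ≤
      RCLike.re ⟪R w - R (Ainv (U.starProjection (R w), 0)).1 -
        (Ainv (U.starProjection (R w), 0)).2 • (v - U.starProjection v), S₀ w⟫_𝕜)
    (w : H) (m : 𝕜) :
    ‖WithLp.toLp 2 (S₀ w, m)‖ ≤
      √((1 + βC ^ 2) / μ ^ 2 + (α + βB * √(1 + βC ^ 2) / μ) ^ 2) *
        ‖WithLp.toLp 2 (R w + m • v, ⟪vr, S₀ w⟫_𝕜)‖ :=
  apriori_bound_of_nested_head_tail R S₀ U hS₀U hS₀U' v ((innerₛₗ 𝕜 vr).comp S₀.toLinearMap)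
    (fun _ hw => inner_apply_eq_zero_of_mem_orthogonal S₀ U hS₀U' hvr hw) Ainv hAleft hμ hα hβB
    hβC hαb hβBb hβCb hcoer w m

end Summit.NavierStokesRegularity.FluidComputer.BorderedHeadTailBoundNested
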